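import Mathlib
import HarnessLib
import Summits.KontsevichZagierPeriods.KontsevichZagierPeriods.Theorems.LinRedNormalFormDihedralNormalFormStubNestedReductionAux11

/-!
# `DihedralNormalForm`, line `torus-descent-sum-shadow`, stub `stub_nestedReduction` — Aux 12

Support file for the stub `stub_nestedReduction` (THEOREM N) of the crux `DihedralNormalForm`
(stmt-KontsevichZagierPeriods-3912, route `LinRedNormalForm`): **bookkeeping of the exponents of
a simple prefix chain** `xᵃ/∏_{p ∈ P}(1 − x_{[0,p]})` in phase (N4).  When `a` is constant on every
annulus (no SD1 exit), `a = Σ_{p ∈ P} c_p 𝟙_{[0,p]}` for a unique `c ∈ ℤᴾ` (`Nested.exists_coeff`,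
telescoping); raising / lowering the multiplicity `c_{p₀}` is the shift move, the normal form is
`c⁰ = (1,…,1,0)` (`Nested.c0`), reached by induction on `Σ |c_p − c⁰_p|` (`Nested.Dm`), and at the
normal form the exponents are the word exponents (`Nested.acP_eq_aword`).

Then **phase (N4)** (`Nested.levelC`): a convergent atom `[q·xᵃ/∏_{p ∈ P}(1 − x_{[0,p]})]` on the
open cube (`0 ∉ P`) is congruent modulo `KZ.relations` to an element of the target
`closure (WAtom ∪ SD1Atom ∪ AtomLT)`: by strong induction on `|P|` — `last ∉ P` or a jump of `a`
inside an annulus give SD1-directed atoms; otherwise one shift move (rule 1b) raises or lowers a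
multiplicity (inner induction on `Dm`), the byproduct having one chord less, and the normal form
IS the word atom of `ε = 𝟙_P`.  Absolute convergence of everything met comes from the
sufficiency half of the convergence criterion (hypothesis `hsuf`, discharged by
`atomConvergence` in the final assembly).

References: F. Brown, *Mixed Tate motives over ℤ*, Ann. of Math. 175 (2012); M. Kontsevich,
D. Zagier, *Periods* (2001), §1.2.
-/

noncomputable section

open MeasureTheory Set

namespace Summit.KontsevichZagierPeriods.DihedralNormalForm.TorusDescent

open Literature.NumberTheory.Transcendental

namespace Nested

open Finset

variable {m : ℕ}

/-- The tail sums `Σ_{p ∈ P, p ≥ l} c_p` (the exponent of `x_l` in `∏ x_{[0,p]}^{c_p}`). -/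
def csum (P : Finset (Fin (m + 1))) (c : Fin (m + 1) → ℤ) (l : Fin (m + 1)) : ℤ :=
  ∑ p ∈ P.filter (fun p => l ≤ p), c p

/-- The exponents `a = Σ_p c_p 𝟙_{[0,p]}` (as naturals). -/
def acP (P : Finset (Fin (m + 1))) (c : Fin (m + 1) → ℤ) : Fin (m + 1) → ℕ :=
  fun l => (csum P c l).toNat

/-- The normal form of the multiplicities: `1` on the inner chords, `0` on the outer one. -/
def c0 (p : Fin (m + 1)) : ℤ := if p = Fin.last m then 0 else 1

/-- The distance to the normal form. -/
def Dm (P : Finset (Fin (m + 1))) (c : Fin (m + 1) → ℤ) : ℕ := ∑ p ∈ P, (c p - c0 p).natAbs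

/-- Changing one multiplicity. -/
def cadd (c : Fin (m + 1) → ℤ) (p₀ : Fin (m + 1)) (δ : ℤ) : Fin (m + 1) → ℤ :=
  fun p => c p + if p = p₀ then δ else 0

/-- Tail sums after changing one multiplicity. -/
theorem csum_cadd {P : Finset (Fin (m + 1))} (c : Fin (m + 1) → ℤ) {p₀ : Fin (m + 1)} (hp₀ : p₀ ∈ P)
    (δ : ℤ) (l : Fin (m + 1)) : csum P (cadd c p₀ δ) l = csum P c l + if l ≤ p₀ then δ else 0 := by
  unfold csum cadd
  rw [sum_add_distrib, sum_ite_eq']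
  simp [mem_filter, hp₀]

/-- Undoing a change. -/
theorem cadd_cadd (c : Fin (m + 1) → ℤ) (p₀ : Fin (m + 1)) (δ : ℤ) : cadd (cadd c p₀ δ) p₀ (-δ) = c := by
  funext p
  unfold cadd
  split_ifs <;> ring

/-- **Raising one multiplicity is the shift of `a` by `𝟙_{[0,p₀]}`.** -/
theorem acP_cadd_one {P : Finset (Fin (m + 1))} {c : Fin (m + 1) → ℤ} (hc : ∀ l, 0 ≤ csum P c l)
    {p₀ : Fin (m + 1)} (hp₀ : p₀ ∈ P) : acP P (cadd c p₀ 1) = aup (acP P c) 0 p₀ := by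
  funext l
  simp only [acP, aup]
  rw [csum_cadd c hp₀]
  have h0 := hc l
  by_cases h : l ≤ p₀
  · rw [if_pos h, if_pos ⟨Fin.zero_le _, h⟩]
    omega
  · rw [if_neg h, if_neg (fun h' => h h'.2)]
    omega

/-- Raising keeps the tail sums non-negative. -/
theorem csum_cadd_one_nonneg {P : Finset (Fin (m + 1))} {c : Fin (m + 1) → ℤ} (hc : ∀ l, 0 ≤ csum P c l)
    {p₀ : Fin (m + 1)} (hp₀ : p₀ ∈ P) (l : Fin (m + 1)) : 0 ≤ csum P (cadd c p₀ 1) l := by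
  rw [csum_cadd c hp₀]
  have := hc l
  split_ifs <;> omega

/-- A tail sum dominates each of its terms when all terms are `≥ 0`. -/
theorem le_csum {P : Finset (Fin (m + 1))} {c : Fin (m + 1) → ℤ} (hc0 : ∀ p ∈ P, 0 ≤ c p)
    {p₀ l : Fin (m + 1)} (hp₀ : p₀ ∈ P) (hl : l ≤ p₀) : c p₀ ≤ csum P c l := by
  unfold csum
  have hmem : p₀ ∈ P.filter (fun p => l ≤ p) := mem_filter.mpr ⟨hp₀, hl⟩
  rw [← add_sum_erase _ _ hmem]
  have : 0 ≤ ∑ p ∈ (P.filter fun p => l ≤ p).erase p₀, c p :=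
    sum_nonneg fun p hp => hc0 p (mem_filter.mp (mem_of_mem_erase hp)).1
  linarith

/-- **Lowering a multiplicity above the normal form keeps the tail sums non-negative.** -/
theorem csum_cadd_neg_one_nonneg {P : Finset (Fin (m + 1))} {c : Fin (m + 1) → ℤ}
    (hge : ∀ p ∈ P, c0 p ≤ c p) {p₀ : Fin (m + 1)} (hp₀ : p₀ ∈ P) (hgt : c0 p₀ < c p₀)
    (l : Fin (m + 1)) : 0 ≤ csum P (cadd c p₀ (-1)) l := by
  have hc0 : ∀ p ∈ P, 0 ≤ c p := fun p hp => le_trans (by unfold c0; split_ifs <;> norm_num) (hge p hp)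
  rw [csum_cadd c hp₀]
  by_cases hl : l ≤ p₀
  · rw [if_pos hl]
    have h1 := le_csum hc0 hp₀ hl
    have h2 : 0 ≤ c0 p₀ := by unfold c0; split_ifs <;> norm_num
    linarith
  · rw [if_neg hl, add_zero]
    unfold csum
    exact sum_nonneg fun p hp => hc0 p (mem_filter.mp hp).1

/-- Raising a multiplicity below the normal form lowers `Dm`. -/
theorem Dm_raise_lt {P : Finset (Fin (m + 1))} (c : Fin (m + 1) → ℤ) {p₀ : Fin (m + 1)} (hp₀ : p₀ ∈ P)
    (hlt : c p₀ < c0 p₀) : Dm P (cadd c p₀ 1) < Dm P c := by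
  unfold Dm
  rw [← add_sum_erase _ _ hp₀, ← add_sum_erase _ (fun p => (c p - c0 p).natAbs) hp₀]
  have hrest : ∑ p ∈ P.erase p₀, (cadd c p₀ 1 p - c0 p).natAbs = ∑ p ∈ P.erase p₀, (c p - c0 p).natAbs :=
    sum_congr rfl fun p hp => by simp [cadd, ne_of_mem_erase hp]
  rw [hrest]
  refine Nat.add_lt_add_right ?_ _
  simp only [cadd, if_true]
  omega

/-- Lowering a multiplicity above the normal form lowers `Dm`. -/
theorem Dm_lower_lt {P : Finset (Fin (m + 1))} (c : Fin (m + 1) → ℤ) {p₀ : Fin (m + 1)} (hp₀ : p₀ ∈ P)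
    (hgt : c0 p₀ < c p₀) : Dm P (cadd c p₀ (-1)) < Dm P c := by
  unfold Dm
  rw [← add_sum_erase _ _ hp₀, ← add_sum_erase _ (fun p => (c p - c0 p).natAbs) hp₀]
  have hrest : ∑ p ∈ P.erase p₀, (cadd c p₀ (-1) p - c0 p).natAbs = ∑ p ∈ P.erase p₀, (c p - c0 p).natAbs :=
    sum_congr rfl fun p hp => by simp [cadd, ne_of_mem_erase hp]
  rw [hrest]
  refine Nat.add_lt_add_right ?_ _
  simp only [cadd, if_true]
  omega

/-- At distance `0` the multiplicities are the normal form. -/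
theorem eq_c0_of_Dm_eq_zero {P : Finset (Fin (m + 1))} {c : Fin (m + 1) → ℤ} (h : Dm P c = 0) :
    ∀ p ∈ P, c p = c0 p := by
  intro p hp
  have := (sum_eq_zero_iff.mp h) p hp
  omega

/-- **At the normal form the exponents are the word exponents.** -/
theorem acP_eq_aword {P : Finset (Fin (m + 1))} (hlast : Fin.last m ∈ P) {c : Fin (m + 1) → ℤ}
    (hc : ∀ p ∈ P, c p = c0 p) : acP P c = aword P := by
  funext l
  unfold acP aword csum
  have hmem : Fin.last m ∈ P.filter (fun p => l ≤ p) := mem_filter.mpr ⟨hlast, Fin.le_last l⟩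
  rw [sum_congr rfl fun p hp => hc p (mem_filter.mp hp).1, ← add_sum_erase _ _ hmem]
  have h1 : ∑ p ∈ (P.filter fun p => l ≤ p).erase (Fin.last m), c0 p =
      (((P.filter fun p => l ≤ p).erase (Fin.last m)).card : ℤ) := by
    rw [Finset.cast_card, sum_congr rfl fun p hp => ?_]
    unfold c0
    rw [if_neg (ne_of_mem_erase hp)]
  rw [h1, card_erase_of_mem hmem]
  simp [c0]

/-! ## From annulus-constant exponents to multiplicities -/

/-- The last tail sum. -/
theorem csum_last (P : Finset (Fin (m + 1))) (c : Fin (m + 1) → ℤ) :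
    csum P c (Fin.last m) = if Fin.last m ∈ P then c (Fin.last m) else 0 := by
  unfold csum
  have : P.filter (fun p => Fin.last m ≤ p) = P.filter (fun p => p = Fin.last m) :=
    filter_congr fun p _ => ⟨fun h => Fin.last_le_iff.mp h, fun h => h ▸ le_rfl⟩
  rw [this, filter_eq', ]
  split_ifs <;> simp

/-- One step of the tail sums. -/
theorem csum_castSucc (P : Finset (Fin (m + 1))) (c : Fin (m + 1) → ℤ) (i : Fin m) :
    csum P c (Fin.castSucc i) = (if Fin.castSucc i ∈ P then c (Fin.castSucc i) else 0) + csum P c i.succ := by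
  unfold csum
  have hsplit : P.filter (fun p => Fin.castSucc i ≤ p) =
      P.filter (fun p => p = Fin.castSucc i) ∪ P.filter (fun p => i.succ ≤ p) := by
    ext p
    simp only [mem_filter, Finset.mem_union]
    constructor
    · rintro ⟨hp, h⟩
      by_cases heq : p = Fin.castSucc i
      · exact Or.inl ⟨hp, heq⟩
      · refine Or.inr ⟨hp, ?_⟩
        rw [Fin.le_def, Fin.val_succ]
        rw [Fin.le_def, Fin.val_castSucc] at h
        have : (p : ℕ) ≠ (i : ℕ) := fun h' => heq (Fin.ext (by rw [Fin.val_castSucc]; exact h'))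
        omega
    · rintro (⟨hp, rfl⟩ | ⟨hp, h⟩)
      · exact ⟨hp, le_rfl⟩
      · refine ⟨hp, ?_⟩
        rw [Fin.le_def, Fin.val_succ] at h
        rw [Fin.le_def, Fin.val_castSucc]
        omega
  have hdisj : Disjoint (P.filter (fun p => p = Fin.castSucc i)) (P.filter (fun p => i.succ ≤ p)) := by
    rw [disjoint_filter]
    intro p _ hp h
    rw [hp, Fin.le_def, Fin.val_succ, Fin.val_castSucc] at h
    omega
  rw [hsplit, sum_union hdisj, filter_eq']
  split_ifs <;> simp

/-- **Telescoping.**  If `a` is constant on every annulus of the chain (`a l = a (l+1)` whenever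
`l ∉ P` is not the last coordinate) and the outer chord is present (`last ∈ P`), then
`a = Σ_{p ∈ P} c_p 𝟙_{[0,p]}` with `c_p = a_p − a_{p+1}` (`c_last = a_last`). -/
theorem exists_coeff {P : Finset (Fin (m + 1))} (hlast : Fin.last m ∈ P) (a : Fin (m + 1) → ℕ)
    (hac : ∀ i : Fin m, Fin.castSucc i ∉ P → a (Fin.castSucc i) = a i.succ) :
    ∃ c : Fin (m + 1) → ℤ, (∀ l, 0 ≤ csum P c l) ∧ acP P c = a := by
  set c : Fin (m + 1) → ℤ := fun p =>
    (a p : ℤ) - Fin.lastCases (0 : ℤ) (fun i : Fin m => (a i.succ : ℤ)) p with hc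
  have key : ∀ l, csum P c l = a l := by
    intro l
    induction l using Fin.reverseInduction with
    | last =>
      rw [csum_last, if_pos hlast, hc]
      simp
    | cast i ih =>
      rw [csum_castSucc, ih]
      by_cases hi : Fin.castSucc i ∈ P
      · rw [if_pos hi, hc]
        simp
      · rw [if_neg hi, zero_add, hac i hi]
  refine ⟨c, fun l => by rw [key]; positivity, funext fun l => ?_⟩
  unfold acP
  rw [key]
  rfl

/-! ## Phase (N4): simple prefix chains reduce to words -/

/-- Simple prefix chains are absolutely convergent (given sufficiency of the criterion). -/
theorem integrableOn_chain
    (hsuf : ∀ (q : ℚ) (a : Fin (m + 1) → ℕ) (e : Fin (m + 1) → Fin (m + 1) → ℤ),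
      (∀ i j : Fin (m + 1), i ≤ j → 0 ≤ alphaS e i j) → IntegrableOn (atomQ (m + 1) q a e) (ocube (m + 1)))
    {P : Finset (Fin (m + 1))} (h0 : (0 : Fin (m + 1)) ∉ P) (q : ℚ) (a : Fin (m + 1) → ℕ) :
    IntegrableOn (atomQ (m + 1) q a (eP P)) (ocube (m + 1)) :=
  hsuf q a (eP P) (alphaS_nonneg_of_reduced (eP_prefix P) (eP_reduced h0).1 (eP_reduced h0).2)

/-- **Phase (N4): simple prefix chains reduce to the target.** -/
theorem levelC
    (hsuf : ∀ (q : ℚ) (a : Fin (m + 1) → ℕ) (e : Fin (m + 1) → Fin (m + 1) → ℤ),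
      (∀ i j : Fin (m + 1), i ≤ j → 0 ≤ alphaS e i j) → IntegrableOn (atomQ (m + 1) q a e) (ocube (m + 1))) :
    ∀ (n : ℕ) (P : Finset (Fin (m + 1))), P.card = n → (0 : Fin (m + 1)) ∉ P →
      ∀ (q : ℚ) (a : Fin (m + 1) → ℕ) (s : KZ.IntegralRep (m + 1)), s.domain = ocube (m + 1) →
        EqOn s.integrand (atomQ (m + 1) q a (eP P)) s.domain →
        ∃ M ∈ Target (m + 1), KZ.of s - M ∈ KZ.relations := by
  intro n
  induction n using Nat.strong_induction_on with
  | _ n IH =>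
  intro P hcard h0
  by_cases hlast : Fin.last m ∈ P
  swap
  · intro q a s hs hi
    exact ⟨KZ.of s, of_mem_target_of_last_not_mem hlast q a s hs hi, by simp⟩
  have herase : ∀ {p₀ : Fin (m + 1)}, p₀ ∈ P → (P.erase p₀).card < n ∧ (0 : Fin (m + 1)) ∉ P.erase p₀ :=
    fun hp₀ => ⟨by rw [Finset.card_erase_of_mem hp₀, hcard]; exact Nat.sub_one_lt (by
      rw [← hcard]; exact (Finset.card_pos.mpr ⟨_, hp₀⟩).ne'),
      fun h => h0 (Finset.mem_of_mem_erase h)⟩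
  -- normalisation of the multiplicities: induction on the distance to the normal form
  have inner : ∀ (D : ℕ) (c : Fin (m + 1) → ℤ), Dm P c = D → (∀ l, 0 ≤ csum P c l) →
      ∀ (q : ℚ) (s : KZ.IntegralRep (m + 1)), s.domain = ocube (m + 1) →
        EqOn s.integrand (atomQ (m + 1) q (acP P c) (eP P)) s.domain →
        ∃ M ∈ Target (m + 1), KZ.of s - M ∈ KZ.relations := by
    intro D
    induction D using Nat.strong_induction_on with
    | _ D IHD =>
    intro c hD hc q s hs hi
    by_cases hD0 : Dm P c = 0
    · -- the normal form IS the word atom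
      have hcw := acP_eq_aword hlast (eq_c0_of_Dm_eq_zero hD0)
      refine ⟨KZ.of s, of_mem_target_of_word q (fun i => decide (i ∈ P)) s hs fun x hx => ?_, by simp⟩
      rw [hi hx, hcw]
      exact word_eqOn hlast q (hs ▸ hx)
    by_cases hneg : ∃ p₀ ∈ P, c p₀ < c0 p₀
    · -- raise the multiplicity of `[0,p₀]`
      obtain ⟨p₀, hp₀, hlt⟩ := hneg
      have hc'n : ∀ l, 0 ≤ csum P (cadd c p₀ 1) l := csum_cadd_one_nonneg hc hp₀
      set s₁ := atomRep (m + 1) q (acP P (cadd c p₀ 1)) (eP P) (integrableOn_chain hsuf h0 q _)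
        with hs₁
      set s₂ := atomRep (m + 1) q (acP P c) (eP (P.erase p₀))
        (integrableOn_chain hsuf (herase hp₀).2 q _) with hs₂
      have hrel : KZ.of s - KZ.of s₁ - KZ.of s₂ ∈ KZ.relations :=
        shift_mem_relations q (acP P c) (eP P) (Fin.zero_le p₀) s s₁ s₂ hs rfl rfl hi
          (fun x _ => by rw [hs₁, atomRep_integrand, acP_cadd_one hc hp₀])
          (fun x _ => by rw [hs₂, atomRep_integrand, eadd_eP hp₀])
      obtain ⟨M₁, hM₁, r₁⟩ :=
        IHD _ (hD ▸ Dm_raise_lt c hp₀ hlt) (cadd c p₀ 1) rfl hc'n q s₁ rfl (fun _ _ => rfl)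
      obtain ⟨M₂, hM₂, r₂⟩ :=
        IH _ (herase hp₀).1 (P.erase p₀) rfl (herase hp₀).2 q (acP P c) s₂ rfl (fun _ _ => rfl)
      refine ⟨M₁ + M₂, add_mem hM₁ hM₂, ?_⟩
      have := add_mem (add_mem hrel r₁) r₂
      convert this using 1
      abel
    · -- all multiplicities are `≥` the normal form; lower one that is `>`
      push Not at hneg
      obtain ⟨p₀, hp₀, hgt⟩ : ∃ p₀ ∈ P, c0 p₀ < c p₀ := by
        by_contra hall
        push Not at hall
        exact hD0 (Finset.sum_eq_zero fun p hp => by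
          have h1 := hneg p hp; have h2 := hall p hp; omega)
      have hc'n : ∀ l, 0 ≤ csum P (cadd c p₀ (-1)) l := csum_cadd_neg_one_nonneg hneg hp₀ hgt
      have hcc : cadd (cadd c p₀ (-1)) p₀ 1 = c := by
        rw [show (1:ℤ) = -(-1) by norm_num]; exact cadd_cadd c p₀ (-1)
      set s₁ := atomRep (m + 1) q (acP P (cadd c p₀ (-1))) (eP P) (integrableOn_chain hsuf h0 q _)
        with hs₁
      set s₂ := atomRep (m + 1) q (acP P (cadd c p₀ (-1))) (eP (P.erase p₀))
        (integrableOn_chain hsuf (herase hp₀).2 q _) with hs₂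
      have hrel : KZ.of s₁ - KZ.of s - KZ.of s₂ ∈ KZ.relations :=
        shift_mem_relations q (acP P (cadd c p₀ (-1))) (eP P) (Fin.zero_le p₀) s₁ s s₂ rfl hs rfl
          (fun _ _ => rfl)
          (fun x hx => by rw [hi hx, ← acP_cadd_one hc'n hp₀, hcc])
          (fun x _ => by rw [hs₂, atomRep_integrand, eadd_eP hp₀])
      obtain ⟨M₁, hM₁, r₁⟩ :=
        IHD _ (hD ▸ Dm_lower_lt c hp₀ hgt) (cadd c p₀ (-1)) rfl hc'n q s₁ rfl (fun _ _ => rfl)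
      obtain ⟨M₂, hM₂, r₂⟩ := IH _ (herase hp₀).1 (P.erase p₀) rfl (herase hp₀).2 q
        (acP P (cadd c p₀ (-1))) s₂ rfl (fun _ _ => rfl)
      refine ⟨M₁ - M₂, sub_mem hM₁ hM₂, ?_⟩
      have := sub_mem (sub_mem r₁ hrel) r₂
      convert this using 1
      abel
  -- the general exponent vector: SD1 exit at a jump, otherwise multiplicities exist
  intro q a s hs hi
  by_cases hjump : ∃ i : Fin m, Fin.castSucc i ∉ P ∧ a (Fin.castSucc i) ≠ a i.succ
  · obtain ⟨i, hiP, hne⟩ := hjump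
    exact ⟨KZ.of s, of_mem_target_of_jump hiP (l₁ := i.succ) (by simp) q a hne s hs hi, by simp⟩
  · push Not at hjump
    obtain ⟨c, hc, hca⟩ := exists_coeff hlast a hjump
    exact inner _ c rfl hc q s hs (hca ▸ hi)

end Nested

/-- **Registered sub-goal `stub_nestedReductionAux12`**: annulus-constant exponents of a simple prefix chain are an integer combination of the chain indicators (`Nested.exists_coeff`). -/
theorem stub_nestedReductionAux12 : ∀ (m : ℕ) (P : Finset (Fin (m + 1))), Fin.last m ∈ P → ∀ (a : Fin (m + 1) → ℕ), (∀ i : Fin m, Fin.castSucc i ∉ P → a (Fin.castSucc i) = a i.succ) → ∃ c : Fin (m + 1) → ℤ, (∀ l : Fin (m + 1), 0 ≤ ∑ p ∈ P.filter (fun p => l ≤ p), c p) ∧ (fun l : Fin (m + 1) => (∑ p ∈ P.filter (fun p => l ≤ p), c p).toNat) = a :=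
  fun _ _ hlast a hac =>
    Nested.exists_coeff hlast a hac

end Summit.KontsevichZagierPeriods.DihedralNormalForm.TorusDescent
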